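import Summits.BirchSwinnertonDyer.Rank1Residual.X5.TwoAdicTargets
import Literature.NumberTheory.EllipticCurves.Greenberg1999.RankZeroEulerCharacteristicAnyPrime
import HarnessLib

/-!
# O1 (X5 at `p = 2`, non-CM): the algebraic control slot at `2` is PUBLISHED (`δ = 0`)

HONEST FRAMING (cell `b2b-bsdres`, run/shared/lean/b2b/bsd-rank1-residual/, verbatim in every
file): the goal of the cell is to DELETE the COMBINATION-SHAPED residual classes of the
Birch–Swinnerton-Dyer formula for ALL analytic-rank `≤ 1` elliptic curves over `ℚ` — "full BSD
formula for every rank `≤ 1` curve in class `C`" assembled STRICTLY from published theorems — so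
that the rank-`≤ 1` remainder becomes exactly the CONSTRUCTION-SHAPED classes, which are TYPED
(missing-input `Prop`s), NOT attempted. This is not "finishing BSD". Research routes; no claim
beyond stated classes; census output = EVIDENCE, never a Literature fact; nothing here is booked;
no mark of RESIDUAL-MAP §I moves.

Typer file 8 of the O1 class-closure folder (seat cc-typer-4). RELABEL of the E1 target
`O1.TwoAdicEulerCharRankZero W δ` (`X5/TwoAdicTargets.lean`, Greenberg's Theorem 4.1 SHAPE at
`p = 2` with a control-term slot `δ`): the o1 refuter's cite-audit (REFUTER-O1.md §7.1 (c):
statement p. 102 parity-free; the printed proof carries `p = 2` — Lemma 4.6 pp. 106–107, 4.7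
p. 109, Lemma 4.11 pp. 118–119 "the key to dealing with the prime 2 … for all p") and the lit seat's
vendored parity-free named fact `Greenberg1999.thm41_charValue_rankZero_anyPrime` (p251438; Greenberg,
LNM 1716 (1999) Thm. 4.1, `[cite: GreenbergLNM1716, Thm. 4.1 (p. 102)]`) make the `δ = 0` instance
a CONSEQUENCE OF A PUBLISHED THEOREM: `twoAdicEulerCharRankZero_zero_of_greenberg`. For the census
(o1 lead PLAN v2 C-items / refuter §8): the algebraic `δ` is NOT a slack source on good-ordinary-`2`
rank-`0` rows; the F3 budget there is the analytic `k` of `O1.KatoDivisibilityAtTwoUpTo` alone.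
Nothing is booked; the named fact is the lit seat's (nothing minted here).
-/

noncomputable section

open scoped Classical

open WeierstrassCurve Literature.NumberTheory.EllipticCurves
  Literature.NumberTheory.EllipticCurves.Rank1Residual

set_option autoImplicit false

namespace Summit.BirchSwinnertonDyer.Rank1Residual.X5.O1

variable (W : WeierstrassCurve ℚ) [W.IsElliptic] [W.IsGloballyMinimal]

/-- **`TwoAdicEulerCharRankZero W 0` from Greenberg's Theorem 4.1 (parity-free named fact).**
Given the vendored fact `Greenberg1999.thm41_charValue_rankZero_anyPrime` (Greenberg, LNM 1716,
Thm. 4.1; `p = 2` carried by Lemmas 4.6/4.7/4.11), the O1 control target holds with `δ = 0`: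
`f_E(0) · #E(ℚ)(2)² ~ 2^{ord₂ ∏ c_ℓ} · #Ẽ(𝔽₂)(2)² · #Sel_{2^∞}(E/ℚ)` at a good ordinary `2`
(`IsOrdinaryAt W 2` = good reduction ∧ `2 ∤ a₂`). [cite: GreenbergLNM1716, Thm. 4.1 (p. 102), Lemma 4.6 (pp. 106–107), Lemma 4.11 (pp. 118–119)] -/
theorem twoAdicEulerCharRankZero_zero_of_greenberg
    (h : Greenberg1999.thm41_charValue_rankZero_anyPrime) : TwoAdicEulerCharRankZero W 0 := by
  intro hord κ γ hκ hγ hγ' D _ hX fE hfE hfin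
  obtain ⟨u, hu⟩ :=
    h.two W hord.1 (by exact_mod_cast hord.2) κ γ hκ hγ hγ' D hX fE hfE hfin
  refine ⟨u, ?_⟩
  rw [add_zero, zpow_natCast]
  exact hu

/-- Conversely nothing is lost: any `δ`-instance with `δ = 0` is literally the printed shape (the
slot was only ever bookkeeping for a feared `p = 2` correction, now excluded). Restatement of
`twoAdicEulerCharRankZero_zero_of_greenberg` as an `iff` with the fact's `p = 2` clause is not
needed by any consumer; we record instead that the slack slot is inert: `δ = 0` suffices.
[folklore] -/
theorem twoAdicEulerCharRankZero_of_greenberg_of_eq_zero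
    (h : Greenberg1999.thm41_charValue_rankZero_anyPrime) {δ : ℤ} (hδ : δ = 0) :
    TwoAdicEulerCharRankZero W δ := by
  subst hδ
  exact twoAdicEulerCharRankZero_zero_of_greenberg W h

end Summit.BirchSwinnertonDyer.Rank1Residual.X5.O1

end
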